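import Summits.CriticalPhenomena.PercolationContinuityZ3.Theorems.PercNearOneGluingNoHeavyLowerTailSahiCombTriWCylinderClosure

/-!
# INDEX SPLITTING for `TRI_W`: a family that ignores an index coordinate splits `triW` over the two index faces

Support file of the one-cut programme (crux `NoHeavyLowerTail`, stmt-CriticalPhenomena-4575; TRI lane of cell `prim-masterthm`, seat P5 gen 25;
memo `FROM-prim-masterthm-p5-g25-CYLINDER-CLOSURE.md` §1).  Companion of `…SahiCombTriWCylinderClosure` (cylinder closure: a minimal
counterexample to `FiveUpSet.TriWIneq` has a test set depending on every FIBRE coordinate).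

Here the INDEX side: on the index cube `Finset (Option β)` write `x.map some` / `insertNone x` for the two copies of `x : Finset β`
(complementation swaps the copies: `(x.map some)ᶜ = insertNone xᶜ`).  If the family `F` ignores the coordinate `none`
(`F (insertNone x) = F (x.map some)` for all `x`), then for EVERY `G` and every test family `P` (no hypotheses at all)

  `triW P F G = triW P (fun x => F (x.map some)) (fun x => G (x.map some)) + triW P (fun x => F (x.map some)) (fun x => G (insertNone x))`

(`triW_eq_add_of_idx_indep`): the two summands of `triW P F G` at `x.map some` and `insertNone x` are, term by term, the summands at `x` of the
two face functionals — an exact identity, no inequality (it is the case `Sh_F = ∅` of the X-peel identity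
`TRI_a = TRI_{a−1}(F⁰,G⁰) + TRI_{a−1}(F¹,G¹) + |Π∩Sh_F∩R'Sh_G| + |ρΠ∩Sh_F∩R'Sh_G| − |ρΠ∩Sh_F∩S'Sh_G|` of the memo, whose remainder is
sign-indefinite in general).  Consequence (**`triW_nonneg_of_idx_indep`**): if `0 ≤ triW P F' G'` for all monotone families of up-sets on the
index cube `Finset β`, then `0 ≤ triW P F G` on `Finset (Option β)` whenever `F` ignores `none`; with the symmetry `F ↔ G` of `triW` and cylinder
closure, a minimal counterexample to `TriWIneq` has its test set depending on every fibre coordinate AND both families depending on every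
index coordinate.
HONEST LABEL: an identity and its immediate corollary; `TriWIneq` itself stays OPEN. [this work]
-/

namespace Summit.CriticalPhenomena.PercolationContinuityZ3.Theorems

namespace FiveUpSet

open Finset

variable {β γ : Type} [DecidableEq β] [Fintype β] [DecidableEq γ] [Fintype γ]

/-- **Index splitting identity.**  If `F (insertNone x) = F (x.map some)` for all `x`, then
`triW P F G = triW P (F ∘ map some) (G ∘ map some) + triW P (F ∘ map some) (G ∘ insertNone)` (as explicit lambdas). [this work] -/
theorem triW_eq_add_of_idx_indep (P : Finset (Finset γ)) (F G : Finset (Option β) → Finset (Finset γ))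
    (hF : ∀ x : Finset β, F (Finset.insertNone x) = F (x.map Function.Embedding.some)) :
    triW P F G = triW P (fun x => F (x.map Function.Embedding.some)) (fun x => G (x.map Function.Embedding.some))
      + triW P (fun x => F (x.map Function.Embedding.some)) (fun x => G (Finset.insertNone x)) := by
  unfold triW
  rw [sum_finset_option_idx, ← sum_add_distrib, ← sum_add_distrib]
  refine sum_congr rfl fun x _ => ?_
  unfold triWTerm
  rw [compl_map_some, compl_insertNone, hF x]
  ring

/-- **Index splitting.**  If `0 ≤ triW P F' G'` for all monotone families of up-sets `F', G'` on the index cube `Finset β`, then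
`0 ≤ triW P F G` for all monotone families of up-sets on `Finset (Option β)` in which `F` ignores the coordinate `none`. [this work] -/
theorem triW_nonneg_of_idx_indep {P : Finset (Finset γ)}
    (h : ∀ (F' G' : Finset β → Finset (Finset γ)),
      (∀ x, IsUpperSet (F' x : Set (Finset γ))) → (∀ x, IsUpperSet (G' x : Set (Finset γ))) → Monotone F' → Monotone G' →
      0 ≤ triW P F' G')
    (F G : Finset (Option β) → Finset (Finset γ))
    (hF : ∀ y, IsUpperSet (F y : Set (Finset γ))) (hG : ∀ y, IsUpperSet (G y : Set (Finset γ))) (hFm : Monotone F) (hGm : Monotone G)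
    (hFi : ∀ x : Finset β, F (Finset.insertNone x) = F (x.map Function.Embedding.some)) :
    0 ≤ triW P F G := by
  rw [triW_eq_add_of_idx_indep P F G hFi]
  have hLo : Monotone (fun x : Finset β => x.map Function.Embedding.some) := fun _ _ hxy => map_subset_map.2 hxy
  exact add_nonneg
    (h _ _ (fun x => hF _) (fun x => hG _) (fun _ _ hxy => hFm (hLo hxy)) (fun _ _ hxy => hGm (hLo hxy)))
    (h _ _ (fun x => hF _) (fun x => hG _) (fun _ _ hxy => hFm (hLo hxy)) (fun _ _ hxy => hGm (Finset.insertNone.monotone hxy)))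

/-- The symmetric statement for `G` ignoring `none`: then `triW P F G = triW P (F ∘ map some) (G ∘ map some) + triW P (F ∘ insertNone) (G ∘ map some)`
(here the two summands at `x.map some` and `insertNone x` are literally the summands of the two face functionals at `x`), hence `0 ≤ triW P F G`
under the same hypothesis on the small index cube. [this work] -/
theorem triW_nonneg_of_idx_indep_right {P : Finset (Finset γ)}
    (h : ∀ (F' G' : Finset β → Finset (Finset γ)),
      (∀ x, IsUpperSet (F' x : Set (Finset γ))) → (∀ x, IsUpperSet (G' x : Set (Finset γ))) → Monotone F' → Monotone G' →
      0 ≤ triW P F' G')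
    (F G : Finset (Option β) → Finset (Finset γ))
    (hF : ∀ y, IsUpperSet (F y : Set (Finset γ))) (hG : ∀ y, IsUpperSet (G y : Set (Finset γ))) (hFm : Monotone F) (hGm : Monotone G)
    (hGi : ∀ x : Finset β, G (Finset.insertNone x) = G (x.map Function.Embedding.some)) :
    0 ≤ triW P F G := by
  have key : triW P F G = triW P (fun x => F (x.map Function.Embedding.some)) (fun x => G (x.map Function.Embedding.some))
      + triW P (fun x => F (Finset.insertNone x)) (fun x => G (x.map Function.Embedding.some)) := by
    unfold triW
    rw [sum_finset_option_idx, ← sum_add_distrib, ← sum_add_distrib]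
    refine sum_congr rfl fun x _ => ?_
    unfold triWTerm
    rw [compl_map_some, compl_insertNone, hGi x, hGi xᶜ]
  rw [key]
  have hLo : Monotone (fun x : Finset β => x.map Function.Embedding.some) := fun _ _ hxy => map_subset_map.2 hxy
  exact add_nonneg
    (h _ _ (fun x => hF _) (fun x => hG _) (fun _ _ hxy => hFm (hLo hxy)) (fun _ _ hxy => hGm (hLo hxy)))
    (h _ _ (fun x => hF _) (fun x => hG _) (fun _ _ hxy => hFm (Finset.insertNone.monotone hxy)) (fun _ _ hxy => hGm (hLo hxy)))

/-! ## Appendix (gen 25, v2): the new unconditional stratum "one family depends on a single index coordinate" -/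

/-- **a = 2, one family depending on one index coordinate.**  On the index cube `Finset (Option β)` with `Fintype.card β = 1` (two index
coordinates), if `F` ignores the coordinate `none` then `0 ≤ triW P F G` for every up-set `P`, every monotone family of up-sets `G` (no nestedness
between `G {some b}`-type values required) — index splitting + the thin-edge theorem `triW_nonneg_of_card_eq_one`.  Not contained in the co-nested /
anti-nested / swap-pair strata (there `G` is constrained on the middle pair). [this work] -/
theorem triW_nonneg_idx_indep_of_card_eq_one (hβ : Fintype.card β = 1) (P : Finset (Finset γ)) (hP : IsUpperSet (P : Set (Finset γ)))
    (F G : Finset (Option β) → Finset (Finset γ))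
    (hF : ∀ y, IsUpperSet (F y : Set (Finset γ))) (hG : ∀ y, IsUpperSet (G y : Set (Finset γ))) (hFm : Monotone F) (hGm : Monotone G)
    (hFi : ∀ x : Finset β, F (Finset.insertNone x) = F (x.map Function.Embedding.some)) :
    0 ≤ triW P F G :=
  triW_nonneg_of_idx_indep (fun F' G' hF' hG' hF'm hG'm => triW_nonneg_of_card_eq_one hβ P F' G' hP hF' hG' hF'm hG'm) F G hF hG hFm hGm hFi

/-- The base part of an index point of the tower cube `Finset (OptPow β k)` (forget the `k` extra index coordinates):
`basePart 0 = id`, `basePart (k+1) y = basePart k (eraseNone y)`. [this work] -/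
def basePart : (k : ℕ) → Finset (OptPow β k) → Finset β
  | 0 => fun y => y
  | k + 1 => fun y => basePart k (Finset.eraseNone y)

/-- **NEW STRATUM: one family depends on a single index coordinate, the other is arbitrary — every `a`, every `n`, every up-set `P`.**
In the tower encoding: index cube `Finset (OptPow β k)` with `Fintype.card β = 1` (so `a = k + 1` index coordinates), `F y = f (basePart k y)` for a
monotone family `f` of up-sets on the one-coordinate cube `Finset β`; then `0 ≤ triW P F G` for EVERY monotone family of up-sets `G`.  Proof: peel the
`k` extra index coordinates one by one with the index-splitting identity (each time `F` ignores the peeled coordinate and both face families of `F` are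
again of the same form), ending with `2^k` thin-edge instances (`triW_nonneg_of_card_eq_one`).  More generally (memo FROM-prim-masterthm-p5-g25 §1) TriWIneq
for `(F, G)` reduces to index cubes of dimension `#(ess F ∩ ess G)` (coordinates essential for BOTH families), so it holds whenever the two families
share at most one essential index coordinate. [this work] -/
theorem triW_nonneg_of_dependsOnBase (hβ : Fintype.card β = 1) (P : Finset (Finset γ)) (hP : IsUpperSet (P : Set (Finset γ)))
    (f : Finset β → Finset (Finset γ)) (hf : ∀ x, IsUpperSet (f x : Set (Finset γ))) (hfm : Monotone f) :
    ∀ (k : ℕ) (F G : Finset (OptPow β k) → Finset (Finset γ)),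
      (∀ y, F y = f (basePart k y)) → (∀ y, IsUpperSet (G y : Set (Finset γ))) → Monotone G → 0 ≤ triW P F G
  | 0 => fun F G hFf hG hGm => by
      have hFeq : F = f := funext fun y => hFf y
      rw [hFeq]
      exact triW_nonneg_of_card_eq_one hβ P f G hP hf hG hfm hGm
  | k + 1 => fun F G hFf hG hGm => by
      have hFi : ∀ x : Finset (OptPow β k), F (Finset.insertNone x) = F (x.map Function.Embedding.some) := by
        intro x
        rw [hFf, hFf]
        show f (basePart k (Finset.eraseNone (Finset.insertNone x))) = f (basePart k (Finset.eraseNone (x.map Function.Embedding.some)))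
        rw [Finset.eraseNone_insertNone, Finset.eraseNone_map_some]
      have key : triW P F G
          = triW P (fun x : Finset (OptPow β k) => F (x.map Function.Embedding.some))
              (fun x : Finset (OptPow β k) => G (x.map Function.Embedding.some))
            + triW P (fun x : Finset (OptPow β k) => F (x.map Function.Embedding.some))
              (fun x : Finset (OptPow β k) => G (Finset.insertNone x)) :=
        triW_eq_add_of_idx_indep P F G hFi
      rw [key]
      have hLo : ∀ y : Finset (OptPow β k), (fun x : Finset (OptPow β k) => F (x.map Function.Embedding.some)) y = f (basePart k y) := by
        intro y
        show F (y.map Function.Embedding.some) = f (basePart k y)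
        rw [hFf]
        show f (basePart k (Finset.eraseNone (y.map Function.Embedding.some))) = f (basePart k y)
        rw [Finset.eraseNone_map_some]
      have hmapmono : Monotone (fun x : Finset (OptPow β k) => x.map (Function.Embedding.some)) := fun _ _ hxy => map_subset_map.2 hxy
      exact add_nonneg
        (triW_nonneg_of_dependsOnBase hβ P hP f hf hfm k _ _ hLo (fun y => hG _) (fun _ _ hxy => hGm (hmapmono hxy)))
        (triW_nonneg_of_dependsOnBase hβ P hP f hf hfm k _ _ hLo (fun y => hG _) (fun _ _ hxy => hGm (Finset.insertNone.monotone hxy)))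


/-! ### The full X-peel identity (index coordinate `none`) and the "disjoint shells" stratum -/

omit [Fintype β] [DecidableEq β] in
/-- `refl` is monotone for inclusion (local copy). [this work] -/
private theorem refl_subset_refl'' {𝒜 ℬ : Finset (Finset γ)} (h : 𝒜 ⊆ ℬ) : refl 𝒜 ⊆ refl ℬ := by
  intro s hs
  rw [mem_refl] at hs ⊢
  exact h hs

/-- **X-peel identity, termwise.**  For families `F, G` on the index cube `Finset (Option β)` with `F (x.map some) ⊆ F (insertNone x)` and
`G (xᶜ.map some) ⊆ G (insertNone xᶜ)` (true for monotone families), writing `D_F = F (insertNone x) ∖ F (x.map some)` and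
`D_G = G (insertNone xᶜ) ∖ G (xᶜ.map some)` for the two index SHELLS at `x` and `xᶜ`:
`triWTerm P F G (x.map some) + triWTerm P F G (insertNone x) = triWTerm P F⁰ G⁰ x + triWTerm P F¹ G¹ x + [#(P∩D_F∩refl D_G) + #(P∩refl D_F∩D_G) − #(P∩refl D_F∩refl D_G)]`
(`F⁰ = F ∘ map some`, `F¹ = F ∘ insertNone`).  The bracket is sign-indefinite in general (P5 gen 12 / TRI.md §8: the X-peel remainder); it vanishes
when `D_F = ∅` (`triW_eq_add_of_idx_indep`). [this work] -/
theorem triWTerm_idx_peel (P : Finset (Finset γ)) (F G : Finset (Option β) → Finset (Finset γ)) (x : Finset β)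
    (hF : F (x.map Function.Embedding.some) ⊆ F (Finset.insertNone x))
    (hG : G (xᶜ.map Function.Embedding.some) ⊆ G (Finset.insertNone xᶜ)) :
    triWTerm P F G (x.map Function.Embedding.some) + triWTerm P F G (Finset.insertNone x)
      = triWTerm P (fun x => F (x.map Function.Embedding.some)) (fun x => G (x.map Function.Embedding.some)) x
        + triWTerm P (fun x => F (Finset.insertNone x)) (fun x => G (Finset.insertNone x)) x
        + ((((P ∩ (F (Finset.insertNone x) \ F (x.map Function.Embedding.some))
                ∩ refl (G (Finset.insertNone xᶜ) \ G (xᶜ.map Function.Embedding.some))).card : ℤ)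
           + (P ∩ refl (F (Finset.insertNone x) \ F (x.map Function.Embedding.some))
                ∩ (G (Finset.insertNone xᶜ) \ G (xᶜ.map Function.Embedding.some))).card)
           - (P ∩ refl (F (Finset.insertNone x) \ F (x.map Function.Embedding.some))
                ∩ refl (G (Finset.insertNone xᶜ) \ G (xᶜ.map Function.Embedding.some))).card) := by
  have h1 := card_shell_inter_add P (F (x.map Function.Embedding.some)) (F (Finset.insertNone x))
    (refl (G (xᶜ.map Function.Embedding.some))) (refl (G (Finset.insertNone xᶜ))) hF (refl_subset_refl'' hG)
  have h2 := card_shell_inter_add P (refl (F (x.map Function.Embedding.some))) (refl (F (Finset.insertNone x)))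
    (G (xᶜ.map Function.Embedding.some)) (G (Finset.insertNone xᶜ)) (refl_subset_refl'' hF) hG
  have h3 := card_shell_inter_add P (refl (F (x.map Function.Embedding.some))) (refl (F (Finset.insertNone x)))
    (refl (G (xᶜ.map Function.Embedding.some))) (refl (G (Finset.insertNone xᶜ))) (refl_subset_refl'' hF) (refl_subset_refl'' hG)
  rw [← refl_sdiff] at h1 h2 h3
  rw [← refl_sdiff] at h3
  unfold triWTerm
  rw [compl_map_some, compl_insertNone]
  push_cast
  have h1' : ((P ∩ (F (Finset.insertNone x) \ F (x.map Function.Embedding.some))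
        ∩ refl (G (Finset.insertNone xᶜ) \ G (xᶜ.map Function.Embedding.some))).card : ℤ)
      + (P ∩ F (Finset.insertNone x) ∩ refl (G (xᶜ.map Function.Embedding.some))).card
      + (P ∩ F (x.map Function.Embedding.some) ∩ refl (G (Finset.insertNone xᶜ))).card
      = (P ∩ F (Finset.insertNone x) ∩ refl (G (Finset.insertNone xᶜ))).card
      + (P ∩ F (x.map Function.Embedding.some) ∩ refl (G (xᶜ.map Function.Embedding.some))).card := by exact_mod_cast h1
  have h2' : ((P ∩ refl (F (Finset.insertNone x) \ F (x.map Function.Embedding.some))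
        ∩ (G (Finset.insertNone xᶜ) \ G (xᶜ.map Function.Embedding.some))).card : ℤ)
      + (P ∩ refl (F (Finset.insertNone x)) ∩ G (xᶜ.map Function.Embedding.some)).card
      + (P ∩ refl (F (x.map Function.Embedding.some)) ∩ G (Finset.insertNone xᶜ)).card
      = (P ∩ refl (F (Finset.insertNone x)) ∩ G (Finset.insertNone xᶜ)).card
      + (P ∩ refl (F (x.map Function.Embedding.some)) ∩ G (xᶜ.map Function.Embedding.some)).card := by exact_mod_cast h2
  have h3' : ((P ∩ refl (F (Finset.insertNone x) \ F (x.map Function.Embedding.some))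
        ∩ refl (G (Finset.insertNone xᶜ) \ G (xᶜ.map Function.Embedding.some))).card : ℤ)
      + (P ∩ refl (F (Finset.insertNone x)) ∩ refl (G (xᶜ.map Function.Embedding.some))).card
      + (P ∩ refl (F (x.map Function.Embedding.some)) ∩ refl (G (Finset.insertNone xᶜ))).card
      = (P ∩ refl (F (Finset.insertNone x)) ∩ refl (G (Finset.insertNone xᶜ))).card
      + (P ∩ refl (F (x.map Function.Embedding.some)) ∩ refl (G (xᶜ.map Function.Embedding.some))).card := by exact_mod_cast h3
  linarith

/-- **X-peel identity for `triW`.**  For monotone families `F, G` on the index cube `Finset (Option β)`: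
`triW P F G = triW P F⁰ G⁰ + triW P F¹ G¹ + Σ_x [#(P∩D_F(x)∩refl D_G(xᶜ)) + #(P∩refl D_F(x)∩D_G(xᶜ)) − #(P∩refl D_F(x)∩refl D_G(xᶜ))]`. [this work] -/
theorem triW_idx_peel (P : Finset (Finset γ)) (F G : Finset (Option β) → Finset (Finset γ)) (hFm : Monotone F) (hGm : Monotone G) :
    triW P F G = triW P (fun x => F (x.map Function.Embedding.some)) (fun x => G (x.map Function.Embedding.some))
      + triW P (fun x => F (Finset.insertNone x)) (fun x => G (Finset.insertNone x))
      + ∑ x : Finset β, ((((P ∩ (F (Finset.insertNone x) \ F (x.map Function.Embedding.some))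
                ∩ refl (G (Finset.insertNone xᶜ) \ G (xᶜ.map Function.Embedding.some))).card : ℤ)
           + (P ∩ refl (F (Finset.insertNone x) \ F (x.map Function.Embedding.some))
                ∩ (G (Finset.insertNone xᶜ) \ G (xᶜ.map Function.Embedding.some))).card)
           - (P ∩ refl (F (Finset.insertNone x) \ F (x.map Function.Embedding.some))
                ∩ refl (G (Finset.insertNone xᶜ) \ G (xᶜ.map Function.Embedding.some))).card) := by
  unfold triW
  rw [sum_finset_option_idx, ← sum_add_distrib, ← sum_add_distrib, ← sum_add_distrib]
  refine sum_congr rfl fun x _ => ?_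
  exact triWTerm_idx_peel P F G x (hFm (map_some_subset_insertNone x)) (hGm (map_some_subset_insertNone xᶜ))

/-- **The "disjoint shells" stratum (conditional form).**  If `0 ≤ triW P F' G'` for all monotone families of up-sets on the index cube `Finset β`
and, on `Finset (Option β)`, the index shells of `F` at `x` and of `G` at `xᶜ` never meet inside `refl P`
(`P ∩ refl D_F(x) ∩ refl D_G(xᶜ) = ∅` for all `x`, i.e. no point of `D_F(x) ∩ D_G(xᶜ)` has its complement in `P`), then `0 ≤ triW P F G`:
the negative term of the X-peel remainder vanishes.  Contains index splitting (`D_F ≡ ∅`) and its mirror. [this work] -/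
theorem triW_nonneg_of_idx_shells_disjoint {P : Finset (Finset γ)}
    (h : ∀ (F' G' : Finset β → Finset (Finset γ)),
      (∀ x, IsUpperSet (F' x : Set (Finset γ))) → (∀ x, IsUpperSet (G' x : Set (Finset γ))) → Monotone F' → Monotone G' →
      0 ≤ triW P F' G')
    (F G : Finset (Option β) → Finset (Finset γ))
    (hF : ∀ y, IsUpperSet (F y : Set (Finset γ))) (hG : ∀ y, IsUpperSet (G y : Set (Finset γ))) (hFm : Monotone F) (hGm : Monotone G)
    (hdisj : ∀ x : Finset β, P ∩ refl (F (Finset.insertNone x) \ F (x.map Function.Embedding.some))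
      ∩ refl (G (Finset.insertNone xᶜ) \ G (xᶜ.map Function.Embedding.some)) = ∅) :
    0 ≤ triW P F G := by
  rw [triW_idx_peel P F G hFm hGm]
  have hLo : Monotone (fun x : Finset β => x.map Function.Embedding.some) := fun _ _ hxy => map_subset_map.2 hxy
  have h0 := h _ _ (fun x => hF (x.map Function.Embedding.some)) (fun x => hG (x.map Function.Embedding.some))
    (fun _ _ hxy => hFm (hLo hxy)) (fun _ _ hxy => hGm (hLo hxy))
  have h1 := h _ _ (fun x => hF (Finset.insertNone x)) (fun x => hG (Finset.insertNone x))
    (fun _ _ hxy => hFm (Finset.insertNone.monotone hxy)) (fun _ _ hxy => hGm (Finset.insertNone.monotone hxy))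
  have hrem : 0 ≤ ∑ x : Finset β, ((((P ∩ (F (Finset.insertNone x) \ F (x.map Function.Embedding.some))
                ∩ refl (G (Finset.insertNone xᶜ) \ G (xᶜ.map Function.Embedding.some))).card : ℤ)
           + (P ∩ refl (F (Finset.insertNone x) \ F (x.map Function.Embedding.some))
                ∩ (G (Finset.insertNone xᶜ) \ G (xᶜ.map Function.Embedding.some))).card)
           - (P ∩ refl (F (Finset.insertNone x) \ F (x.map Function.Embedding.some))
                ∩ refl (G (Finset.insertNone xᶜ) \ G (xᶜ.map Function.Embedding.some))).card) := by
    refine sum_nonneg fun x _ => ?_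
    rw [hdisj x, card_empty]
    push_cast
    linarith [Nat.zero_le ((P ∩ (F (Finset.insertNone x) \ F (x.map Function.Embedding.some))
                ∩ refl (G (Finset.insertNone xᶜ) \ G (xᶜ.map Function.Embedding.some))).card),
      Nat.zero_le ((P ∩ refl (F (Finset.insertNone x) \ F (x.map Function.Embedding.some))
                ∩ (G (Finset.insertNone xᶜ) \ G (xᶜ.map Function.Embedding.some))).card)]
  linarith

/-- **Unconditional at a = 2**: on `Finset (Option β)` with `Fintype.card β = 1`, monotone families of up-sets whose index shells at `x` and `xᶜ` never
meet inside `refl P` satisfy `0 ≤ triW P F G` (X-peel + the thin-edge theorem). [this work] -/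
theorem triW_nonneg_of_idx_shells_disjoint_of_card_eq_one (hβ : Fintype.card β = 1) (P : Finset (Finset γ))
    (hP : IsUpperSet (P : Set (Finset γ))) (F G : Finset (Option β) → Finset (Finset γ))
    (hF : ∀ y, IsUpperSet (F y : Set (Finset γ))) (hG : ∀ y, IsUpperSet (G y : Set (Finset γ))) (hFm : Monotone F) (hGm : Monotone G)
    (hdisj : ∀ x : Finset β, P ∩ refl (F (Finset.insertNone x) \ F (x.map Function.Embedding.some))
      ∩ refl (G (Finset.insertNone xᶜ) \ G (xᶜ.map Function.Embedding.some)) = ∅) :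
    0 ≤ triW P F G :=
  triW_nonneg_of_idx_shells_disjoint (fun F' G' hF' hG' hF'm hG'm => triW_nonneg_of_card_eq_one hβ P F' G' hP hF' hG' hF'm hG'm)
    F G hF hG hFm hGm hdisj

end FiveUpSet

end Summit.CriticalPhenomena.PercolationContinuityZ3.Theorems
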